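import Literature.Probability.Percolation.CorrelationLengthDKTSlabGap
import Literature.Probability.Percolation.QuotientStrictMonotonicityQuantitative
import HarnessLib

/-!
# RSW3 lane (lead, gen 34): THE SLAB GAP AT `p_c(ℤ³)` IS SANDWICHED —
# `exp(−c k) ≤ p_c(S_k) − p_c(ℤ³) ≤ C/√(log k)`

builds on p205010 (kernel theorem, internal audit signed; external expert review pending) — NOT used in this file.

Cell `prim-rsw3` (LANE 3), lead seat, gen 34. Support file (`--supports stmt-CriticalPhenomena-4575`); no
definitions, no named facts, no sorries. The slabs are `S_k = {x ∈ ℤ³ : 0 ≤ x₀ ≤ k}` (`slabGraph 3 k`,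
`L/HalfSpace`), rooted at the origin; `p_c = criticalProbI 3`.

The lane's slab column so far: `p_c(ℤ³) < p_c(S_k)` for every `k` (Aizenman–Grimmett / Martineau–Severo,
`criticalProb_zd_lt_criticalProb_slab`), `p_c(S_k) ↓ p_c(ℤ³)` (Grimmett–Marstrand,
`tendsto_criticalProb_slab`), and at `p_c(ℤ³)` every `S_k` is exponentially subcritical with no rate
uniform in `k` (gen 26, `T/PercAnnulusCrossingSlabSubcritical`). Gen 34 adds the two RATES, both kernel,
both in `Literature/` (theorems the sources prove, with the tree's constants kept):

* from ABOVE, Duminil-Copin–Kozma–Tassion 2020, Thm. 3 (`DKT20.criticalProb_slab_le_add_div_sqrt_log`,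
  `L/CorrelationLengthDKTSlabGap`): `p_c(S_k) ≤ p_c + C/√(log k)` for `k ≥ k₀`;
* from BELOW, Martineau–Severo 2019 run with its Aizenman–Grimmett constant
  (`criticalProb_zd3_add_exp_le_criticalProb_slab`, `L/QuotientStrictMonotonicityQuantitative`):
  `p_c + exp(−c (k+1)) ≤ p_c(S_k)` for every `k`.

This file states the sandwich in the lane's notation:

* `slabGap_sandwich` — `∃ c C > 0, ∃ k₀, ∀ k ≥ k₀: exp(−c k) ≤ p_c(S_k) − p_c(ℤ³) ≤ C/√(log k)`;
* `slabGap_lower_all` — the lower bound for every `k ≥ 1` in the form `exp(−c k) ≤ p_c(S_k) − p_c`;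
* `theta_slab_pos_of_exp_lt_zd3` / `theta_slab_eq_zero_of_lt_exp` — the two rates as statements about
  WHICH slabs percolate: at `p = p_c + δ` every slab of width `k ≥ k₀` with `exp((C/δ)²) < k` percolates,
  and NO slab of width `k` with `δ < exp(−c(k+1))`, i.e. `k + 1 < log(1/δ)/c`, does.

Honest placement: the conjectured truth is `p_c(S_k) − p_c ≍ k^{−1/ν}`, `ν ≈ 0.88` (finite-size scaling);
the kernel window `[e^{−ck}, C/√(log k)]` is what sprinkling (GM made quantitative by DKT) and essential
enhancement (AG made quantitative along MS) give. Neither bound touches the walls (RSW at `p_c(ℤ³)`).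

References: H. Duminil-Copin, G. Kozma, V. Tassion, Progr. Probab. 77 (2020) = arXiv:1902.03207, Thm. 3
[DuminilcopinKozmaTassion2020]; S. Martineau, F. Severo, Ann. Probab. 47 (2019), Thm. 2.1 / Cor. 2.2
[MartineauSevero2019]; M. Aizenman, G. Grimmett, J. Stat. Phys. 63 (1991) [AizenmanGrimmett1991];
G. Grimmett, *Percolation* (1999), §7.1–7.3 [GrimmettPercolation1999].
-/

noncomputable section

namespace Summit.CriticalPhenomena.PercolationContinuityZ3.Theorems.Crossing.SlabGap

open MeasureTheory Literature.Probability.Percolation Literature.Probability.LatticeModels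
open Literature.Probability.Percolation.DKT20

/-- **THE SLAB GAP OF `ℤ³` IS SANDWICHED**: there are `c, C > 0` and `k₀` such that for every `k ≥ k₀`,
`exp(−c k) ≤ p_c(S_k) − p_c(ℤ³) ≤ C/√(log k)`. Upper: Duminil-Copin–Kozma–Tassion's quantitative
Grimmett–Marstrand; lower: Martineau–Severo's essential-enhancement proof run with its constant
(`exp(−c'(k+1)) ≥ exp(−2c' k)` for `k ≥ 1`).
[cite: DuminilcopinKozmaTassion2020, Theorem 3] [cite: MartineauSevero2019, Cor. 2.2] -/
theorem slabGap_sandwich :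
    ∃ c C : ℝ, 0 < c ∧ 0 < C ∧ ∃ k₀ : ℕ, ∀ k : ℕ, k₀ ≤ k →
      Real.exp (-(c * k)) ≤ criticalProb (slabGraph 3 k) (slabOrigin 3 k) - (criticalProbI 3 : ℝ) ∧
      criticalProb (slabGraph 3 k) (slabOrigin 3 k) - (criticalProbI 3 : ℝ) ≤ C / Real.sqrt (Real.log k) := by
  obtain ⟨c', hc', hlow⟩ := criticalProb_zd3_add_exp_le_criticalProb_slab
  obtain ⟨C, hC, k₀, hup⟩ := criticalProb_slab_le_add_div_sqrt_log (d := 3) le_rfl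
  refine ⟨2 * c', C, by positivity, hC, max k₀ 1, fun k hk => ⟨?_, ?_⟩⟩
  · have hk1 : (1 : ℝ) ≤ k := by exact_mod_cast le_of_max_le_right hk
    have hmono : Real.exp (-(2 * c' * k)) ≤ Real.exp (-(c' * (k + 1))) :=
      Real.exp_le_exp.2 (by nlinarith)
    have := hlow k
    rw [coe_criticalProbI]
    linarith
  · have := hup k (le_of_max_le_left hk)
    rw [coe_criticalProbI]
    linarith

/-- **The lower rate at every width `k ≥ 1`**: `exp(−c k) ≤ p_c(S_k) − p_c(ℤ³)` with one `c > 0`.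
[cite: MartineauSevero2019, Cor. 2.2] -/
theorem slabGap_lower_all :
    ∃ c : ℝ, 0 < c ∧ ∀ k : ℕ, 1 ≤ k →
      Real.exp (-(c * k)) ≤ criticalProb (slabGraph 3 k) (slabOrigin 3 k) - (criticalProbI 3 : ℝ) := by
  obtain ⟨c', hc', hlow⟩ := criticalProb_zd3_add_exp_le_criticalProb_slab
  refine ⟨2 * c', by positivity, fun k hk => ?_⟩
  have hk1 : (1 : ℝ) ≤ k := by exact_mod_cast hk
  have hmono : Real.exp (-(2 * c' * k)) ≤ Real.exp (-(c' * (k + 1))) :=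
    Real.exp_le_exp.2 (by nlinarith)
  have := hlow k
  rw [coe_criticalProbI]
  linarith

/-- **Which slabs percolate slightly above `p_c(ℤ³)` (from above)**: there are `C > 0` and `k₀` such that
for every `p` with `p_c < p` and every `k ≥ k₀` with `exp((C/(p − p_c))²) < k`, `θ_{S_k}(0, p) > 0`.
[cite: DuminilcopinKozmaTassion2020, Theorem 3] -/
theorem theta_slab_pos_of_exp_lt_zd3 :
    ∃ C : ℝ, 0 < C ∧ ∃ k₀ : ℕ, ∀ p : unitInterval, criticalProbI 3 < p → ∀ k : ℕ, k₀ ≤ k →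
      Real.exp ((C / ((p : ℝ) - (criticalProbI 3 : ℝ))) ^ 2) < k →
        0 < theta (slabGraph 3 k) (slabOrigin 3 k) p := by
  obtain ⟨C, hC, k₀, h⟩ := theta_slab_pos_of_exp_lt (d := 3) le_rfl
  refine ⟨C, hC, k₀, fun p hp k hk hexp => h p ?_ k hk ?_⟩
  · exact (Subtype.coe_lt_coe.2 hp : ((criticalProbI 3 : unitInterval) : ℝ) < (p : ℝ))
  · simpa [coe_criticalProbI] using hexp

/-- **Which slabs do NOT percolate slightly above `p_c(ℤ³)` (from below)**: there is `c > 0` such that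
for every `p` and every `k` with `p < p_c + exp(−c(k+1))`, `θ_{S_k}(0, p) = 0` — at `p = p_c + δ` no slab
of width `k + 1 < log(1/δ)/c` percolates. [cite: MartineauSevero2019, Cor. 2.2] -/
theorem theta_slab_eq_zero_of_lt_exp :
    ∃ c : ℝ, 0 < c ∧ ∀ (p : unitInterval) (k : ℕ),
      (p : ℝ) < (criticalProbI 3 : ℝ) + Real.exp (-(c * (k + 1))) →
        theta (slabGraph 3 k) (slabOrigin 3 k) p = 0 := by
  obtain ⟨c, hc, hlow⟩ := criticalProb_zd3_add_exp_le_criticalProb_slab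
  refine ⟨c, hc, fun p k hp => ?_⟩
  have hlt : (p : ℝ) < criticalProb (slabGraph 3 k) (slabOrigin 3 k) := by
    have := hlow k
    rw [coe_criticalProbI] at hp
    linarith
  exact theta_eq_zero_of_lt_criticalProb_holds (slabGraph 3 k) (slabOrigin 3 k) p hlt

end Summit.CriticalPhenomena.PercolationContinuityZ3.Theorems.Crossing.SlabGap

end
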